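import Mathlib
import Summits.Ventures.PercRepro2.Defs
import Summits.Ventures.PercRepro2.Graph
import Summits.Ventures.PercRepro2.OneColourSwitch
import Summits.Ventures.PercRepro2.RegionHubSign
import Summits.Ventures.PercRepro2.SideSwitch
import Summits.Ventures.PercRepro2.M9NoPocketDefs
import Summits.Ventures.PercRepro2.M9LoopRS
import Summits.Ventures.PercRepro2.M9GeneralDSplit
import Summits.Ventures.PercRepro2.M9FourParts
import Summits.Ventures.PercRepro2.M9ReachedK
import Summits.Ventures.PercRepro2.M9TwoExHd
import Summits.Ventures.PercRepro2.M9NoPocketRK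
import Summits.Ventures.PercRepro2.M9NoPocket2EXHD
import Summits.Ventures.PercRepro2.M9NoPocketHygiene

/-!
# THEOREMS RK-NP and 2EXHD-NP without the hypotheses «no loop at `d`» and «no `r`–`s` edge»
(blind cell PercRepro2, p3 g37, 2026-08-29; `proofs/P3-POCKETRK.md` §7)

The BAD edges of a marked graph are its loops at `d` and its `r`–`s` edges.  Moving a bad edge
to a loop at `r` keeps `NoPocketAt`, keeps `Tset = ∅`, removes exactly that bad edge
(`mem_erase_iff_bad_update`), leaves the reached sums unchanged (a loop at `d`,
`M9NoPocketHygiene`) or halves them (an `r`–`s` edge).  By induction on the number of bad edges,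
`reachedKSum_nonpos_of_noPocket'` and `two_ex_add_hd_nonpos_of_noPocket'` hold on the class
`{NoPocketAt d, T-free}` alone — THEOREMS RK-NP and 2EXHD-NP with two hypotheses fewer — and
the single-`d` corollaries follow.  Own work; std axioms.
-/

namespace Summit.Ventures.PercRepro2

namespace NoPocket

open Finset Classical RegionHub OneColourSwitch SideSwitch TermSwitch

variable {V : Type*} {E : Type*}

section Bad

variable [DecidableEq E] {ends : E → Sym2 V}

/-- A loop at `r` is neither an `r`–`s` edge nor a loop at `d`. -/
lemma not_bad_rr {r s d : V} (hrs : r ≠ s) (hrd : r ≠ d) :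
    ¬ (s(r, r) = s(r, s) ∨ s(r, r) = s(d, d)) := by
  rintro (h | h)
  · rw [Sym2.eq_iff] at h
    rcases h with ⟨_, h⟩ | ⟨h, _⟩ <;> exact hrs h
  · rw [Sym2.eq_iff] at h
    rcases h with ⟨h, _⟩ | ⟨h, _⟩ <;> exact hrd h

/-- If `S` is the set of bad edges (the `r`–`s` edges and the loops at `d`) of `ends`, then
`S.erase e` is the set of bad edges of the graph with the bad edge `e` moved to a loop at `r`. -/
lemma mem_erase_iff_bad_update {r s d : V} {S : Finset E}
    (hS : ∀ e, e ∈ S ↔ (ends e = s(r, s) ∨ ends e = s(d, d))) (hrs : r ≠ s) (hrd : r ≠ d)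
    (e : E) : ∀ e', e' ∈ S.erase e ↔
      (Function.update ends e s(r, r) e' = s(r, s) ∨
        Function.update ends e s(r, r) e' = s(d, d)) := by
  intro e'
  rw [Finset.mem_erase, hS]
  by_cases h : e' = e
  · subst h
    simp only [Function.update_self, ne_eq, not_true_eq_false, false_and, false_iff]
    exact not_bad_rr hrs hrd
  · simp only [Function.update_of_ne h, ne_eq, h, not_false_eq_true, true_and]

omit [DecidableEq E] in
/-- With no bad edges there is no loop at `d`. -/
lemma no_loop_of_bad_card_zero {r s d : V} {S : Finset E}
    (hS : ∀ e, e ∈ S ↔ (ends e = s(r, s) ∨ ends e = s(d, d))) (h : S.card = 0) :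
    ∀ e, ends e ≠ s(d, d) := by
  intro e he
  have : e ∈ S := (hS e).2 (Or.inr he)
  rw [Finset.card_eq_zero] at h
  rw [h] at this
  exact Finset.notMem_empty e this

omit [DecidableEq E] in
/-- With no bad edges there is no `r`–`s` edge. -/
lemma no_rs_of_bad_card_zero {r s d : V} {S : Finset E}
    (hS : ∀ e, e ∈ S ↔ (ends e = s(r, s) ∨ ends e = s(d, d))) (h : S.card = 0) :
    ∀ e, ends e ≠ s(r, s) := by
  intro e he
  have : e ∈ S := (hS e).2 (Or.inl he)
  rw [Finset.card_eq_zero] at h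
  rw [h] at this
  exact Finset.notMem_empty e this

end Bad

section Transfer

variable [Fintype V] [DecidableEq V] [Fintype E] [DecidableEq E] {ends : E → Sym2 V}
  {r s d : V} {e : E}

omit [Fintype V] [DecidableEq V] [Fintype E] [DecidableEq E] in
/-- A bad edge is not an edge `{d, x}` with `x ≠ d`, nor an edge `{x, r}`, `{x, s}` with
`x ∉ {d, r, s}`. -/
lemma bad_ne {x : V} (he : ends e = s(r, s) ∨ ends e = s(d, d)) (hrd : r ≠ d) (hsd : s ≠ d)
    (hxd : x ≠ d) (hxr : x ≠ r) (hxs : x ≠ s) :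
    ends e ≠ s(d, x) ∧ ends e ≠ s(x, r) ∧ ends e ≠ s(x, s) := by
  rcases he with he | he <;> rw [he] <;> refine ⟨?_, ?_, ?_⟩ <;> intro h <;>
    rw [Sym2.eq_iff] at h <;> rcases h with ⟨h1, h2⟩ | ⟨h1, h2⟩ <;> simp_all

omit [Fintype V] [DecidableEq V] [Fintype E] in
/-- Moving a bad edge to a loop at `r` keeps the no-pocket hypothesis. -/
lemma noPocketAt_update (hnp : NoPocketAt ends d r s) (hrd : r ≠ d) (hsd : s ≠ d)
    (he : ends e = s(r, s) ∨ ends e = s(d, d)) :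
    NoPocketAt (Function.update ends e s(r, r)) d r s := by
  intro e₁ x h1 hxd hxr hxs
  have hne : e₁ ≠ e := by
    rintro rfl
    rw [Function.update_self, Sym2.eq_iff] at h1
    rcases h1 with ⟨h, _⟩ | ⟨_, h⟩ <;> exact hrd h
  rw [Function.update_of_ne hne] at h1
  obtain ⟨e', he'⟩ := hnp e₁ x h1 hxd hxr hxs
  have hne' : e' ≠ e := by
    rintro rfl
    obtain ⟨_, h2, h3⟩ := bad_ne he hrd hsd hxd hxr hxs
    rcases he' with h | h
    · exact h2 h
    · exact h3 h
  refine ⟨e', ?_⟩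
  rw [Function.update_of_ne hne']
  exact he'

omit [Fintype V] in
/-- Moving a bad edge to a loop at `r` keeps `Tset = ∅`. -/
lemma tset_update_eq_empty (hT : Tset ends d r s = ∅) (hrd : r ≠ d) :
    Tset (Function.update ends e s(r, r)) d r s = ∅ := by
  rw [Finset.eq_empty_iff_forall_notMem]
  intro e₁ h1
  rw [mem_Tset] at h1
  by_cases hne : e₁ = e
  · subst hne
    rw [Function.update_self] at h1
    rcases h1 with h | h <;> rw [Sym2.eq_iff] at h
    · rcases h with ⟨h, _⟩ | ⟨_, h⟩ <;> exact hrd h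
    · rcases h with ⟨h, _⟩ | ⟨_, h⟩
      · exact hrd h
      · exact hrd h
  · rw [Function.update_of_ne hne] at h1
    have : e₁ ∈ Tset ends d r s := mem_Tset.2 h1
    rw [hT] at this
    exact Finset.notMem_empty e₁ this

end Transfer

section Theorems

variable [Fintype V] [DecidableEq V] [Fintype E] [DecidableEq E] {ends : E → Sym2 V}
  {p q r s d : V}

/-- **THEOREM RK-NP, hygienic form.**  On the class `{NoPocketAt d, T-free}` the `K`-reached sum
`Σ_{Sep ∧ DOne ∧ d ∈ K₂} σ_pq σ_rs` is non-positive: loops at `d` and `r`–`s` edges are allowed. -/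
theorem reachedKSum_nonpos_of_noPocket' (hnp : NoPocketAt ends d r s) (hpd : p ≠ d) (hqd : q ≠ d)
    (hr : d ≠ r) (hs : d ≠ s) (hT : Tset ends d r s = ∅) : reachedKSum ends p q r s d ≤ 0 := by
  by_cases hrs' : r = s
  · subst hrs'
    unfold reachedKSum
    refine le_of_eq (Finset.sum_eq_zero (fun ω _ => ?_))
    rw [sigma_self, mul_zero]
    split_ifs <;> rfl
  suffices key : ∀ n : ℕ, ∀ (ends : E → Sym2 V) (S : Finset E),
      (∀ e, e ∈ S ↔ (ends e = s(r, s) ∨ ends e = s(d, d))) → S.card = n →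
        NoPocketAt ends d r s → Tset ends d r s = ∅ → reachedKSum ends p q r s d ≤ 0 from
    key _ ends (univ.filter (fun e => ends e = s(r, s) ∨ ends e = s(d, d)))
      (fun e => by simp only [Finset.mem_filter, Finset.mem_univ, true_and]) rfl hnp hT
  intro n
  induction n with
  | zero =>
    intro ends S hS hcard hnp hT
    exact reachedKSum_nonpos_of_noPocket hnp hpd hqd hr hs hT (no_loop_of_bad_card_zero hS hcard)
      (no_rs_of_bad_card_zero hS hcard)
  | succ n ih =>
    intro ends S hS hcard hnp hT
    obtain ⟨e, he⟩ : S.Nonempty := Finset.card_pos.1 (by rw [hcard]; exact Nat.succ_pos n)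
    have hbad := (hS e).1 he
    have hcard' : (S.erase e).card = n := by
      rw [Finset.card_erase_of_mem he, hcard]
      rfl
    have ih' := ih _ (S.erase e) (mem_erase_iff_bad_update hS hrs' hr.symm e) hcard'
      (noPocketAt_update hnp hr.symm hs.symm hbad) (tset_update_eq_empty hT hr.symm)
    rcases hbad with h1 | h2
    · have h2 := reachedKSum_loop_rs (p := p) (q := q) (d := d) h1
      unfold loopRS at h2
      linarith
    · rw [reachedKSum_relocate_loop (e := e) (by rw [h2]; exact Sym2.mk_isDiag_iff.2 rfl) r]
      exact ih'

/-- **Corollary**: the single-`d` sign sum is non-positive on `{NoPocketAt d, T-free}`. -/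
theorem dSignSum_nonpos_of_noPocket_rk' (hnp : NoPocketAt ends d r s) (hpd : p ≠ d) (hqd : q ≠ d)
    (hr : d ≠ r) (hs : d ≠ s) (hT : Tset ends d r s = ∅) : dSignSum ends p q r s d ≤ 0 :=
  dSignSum_nonpos_of_reachedK_nonpos hr hs (reachedKSum_nonpos_of_noPocket' hnp hpd hqd hr hs hT)

/-- **THEOREM 2EXHD-NP, hygienic form.**  On the class `{NoPocketAt d, T-free}`:
`2 · exSum + hdSum ≤ 0`; loops at `d` and `r`–`s` edges are allowed. -/
theorem two_ex_add_hd_nonpos_of_noPocket' (hnp : NoPocketAt ends d r s) (hpd : p ≠ d)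
    (hqd : q ≠ d) (hr : d ≠ r) (hs : d ≠ s) (hT : Tset ends d r s = ∅) :
    2 * exSum ends p q r s d + hdSum ends p q r s d ≤ 0 := by
  by_cases hrs' : r = s
  · subst hrs'
    have h1 : exSum ends p q r r d = 0 := by
      unfold exSum
      refine Finset.sum_eq_zero (fun ω _ => ?_)
      rw [sigma_self, mul_zero]
      split_ifs <;> rfl
    have h2 : hdSum ends p q r r d = 0 := by
      unfold hdSum
      refine Finset.sum_eq_zero (fun ω _ => ?_)
      rw [sigma_self, mul_zero]
      split_ifs <;> rfl
    rw [h1, h2]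
    norm_num
  suffices key : ∀ n : ℕ, ∀ (ends : E → Sym2 V) (S : Finset E),
      (∀ e, e ∈ S ↔ (ends e = s(r, s) ∨ ends e = s(d, d))) → S.card = n →
        NoPocketAt ends d r s → Tset ends d r s = ∅ →
          2 * exSum ends p q r s d + hdSum ends p q r s d ≤ 0 from
    key _ ends (univ.filter (fun e => ends e = s(r, s) ∨ ends e = s(d, d)))
      (fun e => by simp only [Finset.mem_filter, Finset.mem_univ, true_and]) rfl hnp hT
  intro n
  induction n with
  | zero =>
    intro ends S hS hcard hnp hT
    exact two_ex_add_hd_nonpos_of_noPocket hnp hpd hqd hr hs hT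
      (no_loop_of_bad_card_zero hS hcard) (no_rs_of_bad_card_zero hS hcard)
  | succ n ih =>
    intro ends S hS hcard hnp hT
    obtain ⟨e, he⟩ : S.Nonempty := Finset.card_pos.1 (by rw [hcard]; exact Nat.succ_pos n)
    have hbad := (hS e).1 he
    have hcard' : (S.erase e).card = n := by
      rw [Finset.card_erase_of_mem he, hcard]
      rfl
    have ih' := ih _ (S.erase e) (mem_erase_iff_bad_update hS hrs' hr.symm e) hcard'
      (noPocketAt_update hnp hr.symm hs.symm hbad) (tset_update_eq_empty hT hr.symm)
    rcases hbad with h1 | h2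
    · have h2 := exSum_loop_rs (p := p) (q := q) (d := d) h1
      have h3 := hdSum_loop_rs (p := p) (q := q) (d := d) h1
      unfold loopRS at h2 h3
      linarith
    · have hd : (ends e).IsDiag := by rw [h2]; exact Sym2.mk_isDiag_iff.2 rfl
      rw [exSum_relocate_loop (e := e) hd r, hdSum_relocate_loop (e := e) hd r]
      exact ih'

/-- **Corollary**: the single-`d` sign sum is non-positive on `{NoPocketAt d, T-free}` (through
`M9TwoExHd`). -/
theorem dSignSum_nonpos_of_noPocket_two_ex_hd' (hnp : NoPocketAt ends d r s) (hpd : p ≠ d)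
    (hqd : q ≠ d) (hr : d ≠ r) (hs : d ≠ s) (hT : Tset ends d r s = ∅) :
    dSignSum ends p q r s d ≤ 0 :=
  dSignSum_nonpos_of_two_ex_add_hd hr hs (two_ex_add_hd_nonpos_of_noPocket' hnp hpd hqd hr hs hT)

end Theorems

end NoPocket

end Summit.Ventures.PercRepro2
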